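/-
Copyright: the b2b-balaban T⁴-continuum CRUX team, row NE7b leaf lineage `t4-ne7b-formalise-leaf-06` (gen 161). Project licence.
-/
import Summits.QuantumFields.BalabanUV.T4Continuum.Spine.NE7b.SupEquationTowerStep

/-!
# THE EQUATION-MAP TOWER OVER ℕ: from the fine equation map `Eq₀` on `X 0` and ℕ-indexed user data (blockings, charts in the
# admissible-section form, numbers with the displayed recursions) — branches `σ_k : X (k+1) → X k` AT EVERY LEVEL, the derived equation
# maps `Eq_{k+1} = Q_k∘Eq_k∘σ_k`, the linearised composite sections `𝒮_{k+1} = 𝒮_k∘Dσ_k(0)`, the composite transports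
# `Φ_{k+1} = Φ_k∘σ_k : X (k+1) → X 0`, and THE `k`-STEP LIFT `Eq_k w = 0 → Eq₀(Φ_k w) = 0` with `Φ_k` `(∏_{j<k} (N_j⁻¹ − c_j)⁻¹)`-Lipschitz
# on `closedBall 0 r_k` (row NE7b, node U5c; `…SupEquationTowerStep.towerStep` BY NAME under `Nat.rec`; [folklore]; any Banach currencies)

Cell `pub-balaban`, sub-cell `t4`, spine estimate NE7b (`T4WeightBudget.RelWeightBound`; the cell's OWN estimate — NOT PRINTED in
[Bałaban 1983–89], NOT PROVED).  Crux-route work under `Spine/NE7b/` by a row leaf (`t4-ne7b-formalise-leaf-06` gen 161) under FREEZE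
(0)'s crux-prover clause — the `n`-step object this lineage's `…SupEquationTwoSteps` (STS) listed under NOT HERE; NOTHING of Bałaban's
is named as a Lean object, valued or asserted; no `T4Continuum/Support` leaf typed; no `def` (the tower's families are EXISTENTIAL
outputs pinned by their recursion equations); zero `sorry`.  Import: this lineage's `…SupEquationTowerStep` (through it SIS).

WHY (located).  SIS is one step, STS two; the hard-step road is an induction over all scales.  `…SupEquationTowerStep.towerStep` is the
re-entrant invariant («`Eq_k` is `C¹` on `closedBall 0 r_k` with letters `(B_k, M_k)`, `Eq_k 0 = 0`, `Eq_k′(0) = 𝒬_k∘Eq₀′(0)∘𝒮_k`, `𝒮_k`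
admissible»); THIS FILE runs it under `Nat.rec` on the Σ-type of states (inside the proof — no `def`), names the outputs existentially
with their recursion equations, and adds the composite transport `Φ_k = σ_0∘⋯∘σ_{k−1}` with its three letters: it maps `closedBall 0 r_k`
into `closedBall 0 r_0`, it is `(∏_{j<k} K₁ⱼ)`-Lipschitz there (`K₁ⱼ = (N_j⁻¹ − c_j)⁻¹`), and zeros of the `k`-times coarsened equation
are zeros of the fine equation at the `k`-times transported background.  HONEST BOOKKEEPING (the pricing desk's located note on STS,
PRICING-NE7b v132 F784, booked verbatim): the composite section's Lipschitz letter is the PRODUCT `∏_{j<k} (N_j⁻¹ − c_j)⁻¹` — each factor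
`> 1` as soon as `N_j > 1` — and the radii obey `r_{k+1} < (N_k⁻¹ − c_k)·r_k`, so `r_k < r_0·∏_{j<k}(N_j⁻¹ − c_j)`; the moduli `M_k` grow by
`‖Q_k‖K₁ₖ²(1 + B_kK₁ₖC_{P_k})` and the smallness `C_{P_k}M_kr_k ≤ c_k < N_k⁻¹` is a hypothesis AT EVERY LEVEL.  The tower is TRUE AND
DISPLAYED: whether its hypotheses can be met along an actual blocking sequence is the control (rescaling ∕ kernel decay ∕ (A3)) that
belongs to the junction not typed here.

WHAT IS PROVED ([folklore]; `X, K : ℕ → Type`, every `X k` a nontrivial real Banach space, every `K k` real normed):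
* §1 `lipschitzOnWith_id_one` (the empty product), `prod_range_succ_K₁` (bookkeeping of the product letter).
* §2 **`tower_eq`** — DATA: `Q_k, Lp_k, P_k, ι_k` (`ι_k(P_k h) = h − Lp_k(Q_k h)`, `‖P_k‖ ≤ C_{P_k}`), `𝒬_0 = 1`, `𝒬_{k+1} = Q_k∘𝒬_k`;
  `Eq₀, Eq₀′` with `Eq₀ 0 = 0` and `C¹` letters `(B_0, M_0)` on `closedBall 0 r_0`; charts `T_k : X k ≃L X (k+1) × K k` with «for every
  `𝒮 : X k →L X 0` with `𝒬_k∘𝒮 = 1` and `P_j(𝒬_j(Eq₀′(0)(𝒮 h))) = 0` for all `j < k`: `T_k h = (Q_k h, P_k(𝒬_k(Eq₀′(0)(𝒮 h))))`»,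
  `‖T_k⁻¹ y‖ ≤ N_k‖y‖`; numbers `c_k < N_k⁻¹`, `C_{P_k}M_kr_k ≤ c_k`, `0 ≤ r_k`, `r_{k+1} < (N_k⁻¹ − c_k)r_k`, `0 ≤ M_k`,
  `‖Q_k‖B_kK₁ₖ ≤ B_{k+1}`, `‖Q_k‖(M_kK₁ₖK₁ₖ + B_k(K₁ₖ²(C_{P_k}M_k)K₁ₖ)) ≤ M_{k+1}` ⟹ `∃ σ Eq Eq′ 𝒮 Φ` with
  (R) the recursion equations (`Eq 0 = Eq₀`, `Eq′ 0 = Eq₀′`, `𝒮 0 = 1`, `Φ 0 = id`, `Eq (k+1) = Q_k∘Eq k∘σ k`,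
      `Eq′ (k+1) w = Q_k∘Eq′ k (σ k w)∘Dσ_k(w)`, `𝒮 (k+1) = 𝒮 k∘Dσ_k(0)`, `Φ (k+1) = Φ k∘σ k`);
  (S) at every level the state letters (`Eq k 0 = 0`; `HasFDerivAt`, bound `B_k`, modulus `M_k` on `closedBall 0 r_k`; `𝒬_k∘𝒮 k = 1`;
      admissibility; `Eq′ k 0 = 𝒬_k∘Eq₀′(0)∘𝒮 k`);
  (B) at every level the branch letters (`σ k 0 = 0`; on `closedBall 0 ρ_k`: ball membership, `Q_k(σ k w) = w`, `P_k(Eq k (σ k w)) = 0`,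
      THE TOWER LIFT `Eq k (σ k w) = Lp_k(Eq (k+1) w)`; `K₁ₖ`-Lipschitz; uniqueness; on `ball 0 ρ_k`: differentiable, `‖Dσ_k‖ ≤ K₁ₖ`, `Q_k∘Dσ_k = 1`);
  (C) at every level the composite letters (`Φ k 0 = 0`; `Φ k` maps `closedBall 0 r_k` into `closedBall 0 r_0`; it is a SECTION of
      the composite blocking there, `𝒬_k(Φ k w) = w`; `LipschitzOnWith (∏_{j<k} (N_j⁻¹ − c_j)⁻¹) (Φ k) (closedBall 0 r_k)`; **`Eq k w = 0 → Eq₀ (Φ k w) = 0`** on `closedBall 0 r_k`).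
* §3 **`tower_eq_const`** — the constant-blocking specialisation (`X k = E`, one `(Q, Lp, P, ι)`, composite blockings `Q ^ k`): the
  `ℓ^∞(ℤ^d)` shape, where the coarse lattice is again `ℤ^d` and every level uses the same block average; non-dependent outputs.
* §4 toy: the product letter after two levels (`example`).

NOT HERE (honest): charts `T_k`, `N_k` BY VALUE (for the free part ASE at the composite side; the interacting correction is the OWNER's
(61) road; uniqueness of admissible sections is how an instance discharges the universal form); any control of the displayed recursions
(the tower does NOT assert that its hypotheses can be met for all `k` by a given model); the `ℓ^∞(ℤ^d)` instance; the pairing identity;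
(A3) ∕ (A1c); NC-NE7b-α UNRULED; anything of Bałaban's.  BY-NAME EFFECT ON THE WALL: NONE.  NE7b NOT PRINTED ∕ NOT PROVED; spine PROVED
0∕9; rung (B)+1 on a FINITE torus — NOT infinite volume, NOT the mass gap, NOT Clay.  HONEST DEPENDENCY: continuum YM on T⁴ ⇐ BetaPertH ∧
nine spine estimates (0∕9 proved); BetaPertH ⇐ (D1) ∧ (D4) ∧ CAP+tail; G-an2-4 gates asym, D1 and NE2∕3∕4.
-/

set_option autoImplicit false

noncomputable section

namespace Summit.QuantumFields.BalabanUV.T4Continuum.NE7b.SupEquationTower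

open Set Metric Function
open scoped NNReal
open Summit.QuantumFields.BalabanUV.T4Continuum.NE7b

/-! ## §1. Two bookkeeping letters -/

/-- The identity is `1`-Lipschitz on any set (the empty product of the tower's Lipschitz letters). [folklore] -/
theorem lipschitzOnWith_id_one {E : Type*} [NormedAddCommGroup E] (s : Set E) : LipschitzOnWith 1 (id : E → E) s :=
  LipschitzWith.id.lipschitzOnWith

/-- The product letter's recursion: `∏_{j<k+1} K₁ⱼ = K₁ₖ · ∏_{j<k} K₁ⱼ` in the order `LipschitzOnWith.comp` produces. [folklore] -/
theorem prod_range_succ_K₁ (N c : ℕ → ℝ≥0) (k : ℕ) :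
    (∏ j ∈ Finset.range (k + 1), ((N j)⁻¹ - c j)⁻¹) = (∏ j ∈ Finset.range k, ((N j)⁻¹ - c j)⁻¹) * ((N k)⁻¹ - c k)⁻¹ :=
  Finset.prod_range_succ _ k

/-! ## §2. THE TOWER -/

variable {X : ℕ → Type*} {K : ℕ → Type*} [∀ k, NormedAddCommGroup (X k)] [∀ k, NormedSpace ℝ (X k)]
  [∀ k, NormedAddCommGroup (K k)] [∀ k, NormedSpace ℝ (K k)]

/-- **THE EQUATION-MAP TOWER OVER ℕ.**  See the module docstring, §2: data (blockings, composite blockings, the fine equation map with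
its `C¹` letters, charts in the admissible-section form, numbers with the displayed recursions) ⟹ branches, derived equation maps,
linearised composite sections and composite transports at every level, with (R) recursion equations, (S) state letters, (B) branch
letters and (C) composite letters — in particular the `k`-step lift `Eq k w = 0 → Eq₀ (Φ k w) = 0`. [folklore] -/
theorem tower_eq [∀ k, CompleteSpace (X k)] [∀ k, Nontrivial (X k)]
    (Q : ∀ k, X k →L[ℝ] X (k + 1)) (Lp : ∀ k, X (k + 1) →L[ℝ] X k) (P : ∀ k, X k →L[ℝ] K k) (ι : ∀ k, K k →L[ℝ] X k)
    (hPι : ∀ k h, ι k (P k h) = h - Lp k (Q k h)) {CP : ℕ → ℝ} (hCP : ∀ k, ‖P k‖ ≤ CP k)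
    (𝒬 : ∀ k, X 0 →L[ℝ] X k) (h𝒬0 : 𝒬 0 = ContinuousLinearMap.id ℝ (X 0)) (h𝒬 : ∀ k, 𝒬 (k + 1) = (Q k).comp (𝒬 k))
    {Eq₀ : X 0 → X 0} {Eq₀' : X 0 → X 0 →L[ℝ] X 0} (hE0 : Eq₀ 0 = 0)
    {r B M : ℕ → ℝ} (hr0 : ∀ k, 0 ≤ r k) (hM0 : ∀ k, 0 ≤ M k)
    (hE : ∀ x ∈ closedBall (0 : X 0) (r 0), HasFDerivAt Eq₀ (Eq₀' x) x)
    (hB : ∀ x ∈ closedBall (0 : X 0) (r 0), ‖Eq₀' x‖ ≤ B 0)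
    (hM : ∀ x ∈ closedBall (0 : X 0) (r 0), ∀ x' ∈ closedBall (0 : X 0) (r 0), ‖Eq₀' x - Eq₀' x'‖ ≤ M 0 * ‖x - x'‖)
    (T : ∀ k, X k ≃L[ℝ] X (k + 1) × K k) {N c : ℕ → ℝ≥0}
    (hT : ∀ k (𝒮 : X k →L[ℝ] X 0), (𝒬 k).comp 𝒮 = ContinuousLinearMap.id ℝ (X k) →
      (∀ j, j < k → ∀ h, P j (𝒬 j (Eq₀' 0 (𝒮 h))) = 0) → ∀ h, T k h = (Q k h, P k (𝒬 k (Eq₀' 0 (𝒮 h)))))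
    (hN : ∀ k (y : X (k + 1) × K k), ‖(T k).symm y‖ ≤ N k * ‖y‖) (hcN : ∀ k, c k < (N k)⁻¹)
    (hc : ∀ k, CP k * M k * r k ≤ (c k : ℝ)) (hr : ∀ k, r (k + 1) < ((N k : ℝ)⁻¹ - c k) * r k)
    (hBs : ∀ k, ‖Q k‖ * B k * ((N k : ℝ)⁻¹ - c k)⁻¹ ≤ B (k + 1))
    (hMs : ∀ k, ‖Q k‖ * (M k * ((N k : ℝ)⁻¹ - c k)⁻¹ * ((N k : ℝ)⁻¹ - c k)⁻¹ +
      B k * ((((N k : ℝ)⁻¹ - c k)⁻¹) ^ 2 * (CP k * M k) * ((N k : ℝ)⁻¹ - c k)⁻¹)) ≤ M (k + 1)) :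
    ∃ (σ : ∀ k, X (k + 1) → X k) (Eq : ∀ k, X k → X k) (Eq' : ∀ k, X k → X k →L[ℝ] X k) (𝒮 : ∀ k, X k →L[ℝ] X 0)
      (Φ : ∀ k, X k → X 0),
      -- (R) the recursion equations
      Eq 0 = Eq₀ ∧ Eq' 0 = Eq₀' ∧ 𝒮 0 = ContinuousLinearMap.id ℝ (X 0) ∧ Φ 0 = id ∧
      (∀ k, Eq (k + 1) = fun w => Q k (Eq k (σ k w))) ∧
      (∀ k, Eq' (k + 1) = fun w => (Q k).comp ((Eq' k (σ k w)).comp (fderiv ℝ (σ k) w))) ∧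
      (∀ k, 𝒮 (k + 1) = (𝒮 k).comp (fderiv ℝ (σ k) 0)) ∧
      (∀ k, Φ (k + 1) = Φ k ∘ σ k) ∧
      -- (S) the state letters at every level
      (∀ k, Eq k 0 = 0 ∧ (∀ x ∈ closedBall (0 : X k) (r k), HasFDerivAt (Eq k) (Eq' k x) x) ∧
        (∀ x ∈ closedBall (0 : X k) (r k), ‖Eq' k x‖ ≤ B k) ∧
        (∀ x ∈ closedBall (0 : X k) (r k), ∀ x' ∈ closedBall (0 : X k) (r k), ‖Eq' k x - Eq' k x'‖ ≤ M k * ‖x - x'‖) ∧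
        (𝒬 k).comp (𝒮 k) = ContinuousLinearMap.id ℝ (X k) ∧
        (∀ j, j < k → ∀ h, P j (𝒬 j (Eq₀' 0 (𝒮 k h))) = 0) ∧
        Eq' k 0 = (𝒬 k).comp ((Eq₀' 0).comp (𝒮 k))) ∧
      -- (B) the branch letters at every level
      (∀ k, σ k 0 = 0 ∧
        (∀ w ∈ closedBall (0 : X (k + 1)) (((N k : ℝ)⁻¹ - c k) * r k),
          σ k w ∈ closedBall (0 : X k) (r k) ∧ Q k (σ k w) = w ∧ P k (Eq k (σ k w)) = 0 ∧ Eq k (σ k w) = Lp k (Eq (k + 1) w)) ∧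
        LipschitzOnWith ((N k)⁻¹ - c k)⁻¹ (σ k) (closedBall (0 : X (k + 1)) (((N k : ℝ)⁻¹ - c k) * r k)) ∧
        (∀ x ∈ closedBall (0 : X k) (r k), P k (Eq k x) = 0 → σ k (Q k x) = x) ∧
        (∀ w ∈ ball (0 : X (k + 1)) (((N k : ℝ)⁻¹ - c k) * r k), DifferentiableAt ℝ (σ k) w ∧
          ‖fderiv ℝ (σ k) w‖ ≤ ((N k : ℝ)⁻¹ - c k)⁻¹ ∧ (Q k).comp (fderiv ℝ (σ k) w) = ContinuousLinearMap.id ℝ (X (k + 1)))) ∧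
      -- (C) the composite letters at every level
      (∀ k, Φ k 0 = 0 ∧ (∀ w ∈ closedBall (0 : X k) (r k), Φ k w ∈ closedBall (0 : X 0) (r 0)) ∧
        (∀ w ∈ closedBall (0 : X k) (r k), 𝒬 k (Φ k w) = w) ∧
        LipschitzOnWith (∏ j ∈ Finset.range k, ((N j)⁻¹ - c j)⁻¹) (Φ k) (closedBall (0 : X k) (r k)) ∧
        (∀ w ∈ closedBall (0 : X k) (r k), Eq k w = 0 → Eq₀ (Φ k w) = 0)) := by
  -- the state predicate at level `k` and the Σ-type of states
  let Inv : (k : ℕ) → (X k → X k) → (X k → X k →L[ℝ] X k) → (X k →L[ℝ] X 0) → Prop := fun k E E' S =>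
    E 0 = 0 ∧ (∀ x ∈ closedBall (0 : X k) (r k), HasFDerivAt E (E' x) x) ∧
      (∀ x ∈ closedBall (0 : X k) (r k), ‖E' x‖ ≤ B k) ∧
      (∀ x ∈ closedBall (0 : X k) (r k), ∀ x' ∈ closedBall (0 : X k) (r k), ‖E' x - E' x'‖ ≤ M k * ‖x - x'‖) ∧
      (𝒬 k).comp S = ContinuousLinearMap.id ℝ (X k) ∧
      (∀ j, j < k → ∀ h, P j (𝒬 j (Eq₀' 0 (S h))) = 0) ∧
      E' 0 = (𝒬 k).comp ((Eq₀' 0).comp S)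
  let St : (k : ℕ) → Type _ := fun k =>
    {p : (X k → X k) × (X k → X k →L[ℝ] X k) × (X k →L[ℝ] X 0) // Inv k p.1 p.2.1 p.2.2}
  -- the branch letters at level `k`
  let Br : (k : ℕ) → (X k → X k) → (X (k + 1) → X k) → Prop := fun k E s =>
    s 0 = 0 ∧
      (∀ w ∈ closedBall (0 : X (k + 1)) (((N k : ℝ)⁻¹ - c k) * r k),
        s w ∈ closedBall (0 : X k) (r k) ∧ Q k (s w) = w ∧ P k (E (s w)) = 0 ∧ E (s w) = Lp k (Q k (E (s w)))) ∧
      LipschitzOnWith ((N k)⁻¹ - c k)⁻¹ s (closedBall (0 : X (k + 1)) (((N k : ℝ)⁻¹ - c k) * r k)) ∧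
      (∀ x ∈ closedBall (0 : X k) (r k), P k (E x) = 0 → s (Q k x) = x) ∧
      (∀ w ∈ ball (0 : X (k + 1)) (((N k : ℝ)⁻¹ - c k) * r k), DifferentiableAt ℝ s w ∧
        ‖fderiv ℝ s w‖ ≤ ((N k : ℝ)⁻¹ - c k)⁻¹ ∧ (Q k).comp (fderiv ℝ s w) = ContinuousLinearMap.id ℝ (X (k + 1))) ∧
      (∀ w ∈ closedBall (0 : X (k + 1)) (((N k : ℝ)⁻¹ - c k) * r k), Q k (E (s w)) = 0 → E (s w) = 0)
  -- the re-entrant step (`…SupEquationTowerStep.towerStep` BY NAME)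
  have step : ∀ k (s : St k), ∃ σ : X (k + 1) → X k, Br k s.1.1 σ ∧
      Inv (k + 1) (fun w => Q k (s.1.1 (σ w))) (fun w => (Q k).comp ((s.1.2.1 (σ w)).comp (fderiv ℝ σ w)))
        (s.1.2.2.comp (fderiv ℝ σ 0)) := by
    intro k s
    obtain ⟨h1, h2, h3, h4, h5, h6, h7⟩ := s.2
    obtain ⟨σ, hσ0, ha, hlip, huniq, hb, hd, n1, n2, n3, n4, n5, n6, n7⟩ :=
      SupEquationTowerStep.towerStep Q Lp P ι hPι hCP 𝒬 h𝒬 (Eq₀' 0) hr0 hM0 T hT hN hcN hc hr hBs hMs k h1 h2 h3 h4 h5 h6 h7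
    exact ⟨σ, ⟨hσ0, ha, hlip, huniq, hb, hd⟩, ⟨n1, n2, n3, n4, n5, n6, n7⟩⟩
  -- the initial state
  have inv0 : Inv 0 Eq₀ Eq₀' (ContinuousLinearMap.id ℝ (X 0)) := by
    refine ⟨hE0, hE, hB, hM, by rw [h𝒬0]; rfl, fun j hj => absurd hj (Nat.not_lt_zero j), ?_⟩
    rw [h𝒬0]; rfl
  -- the recursion over ℕ on the Σ-type of states
  let st : (k : ℕ) → St k := fun k =>
    Nat.rec (motive := fun k => St k) ⟨(Eq₀, Eq₀', ContinuousLinearMap.id ℝ (X 0)), inv0⟩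
      (fun k s => ⟨(fun w => Q k (s.1.1 ((step k s).choose w)),
        fun w => (Q k).comp ((s.1.2.1 ((step k s).choose w)).comp (fderiv ℝ (step k s).choose w)),
        s.1.2.2.comp (fderiv ℝ (step k s).choose 0)), (step k s).choose_spec.2⟩) k
  let σ : ∀ k, X (k + 1) → X k := fun k => (step k (st k)).choose
  let Φ : ∀ k, X k → X 0 := fun k => Nat.rec (motive := fun k => X k → X 0) id (fun k f => f ∘ σ k) k
  have hBr : ∀ k, Br k (st k).1.1 (σ k) := fun k => (step k (st k)).choose_spec.1
  have hEs : ∀ k w, (st (k + 1)).1.1 w = Q k ((st k).1.1 (σ k w)) := fun _ _ => rfl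
  have hΦs : ∀ k w, Φ (k + 1) w = Φ k (σ k w) := fun _ _ => rfl
  -- the next radius sits inside the closed chart ball
  have hsub : ∀ k, closedBall (0 : X (k + 1)) (r (k + 1)) ⊆ closedBall (0 : X (k + 1)) (((N k : ℝ)⁻¹ - c k) * r k) :=
    fun k => closedBall_subset_closedBall (hr k).le
  -- (C) by induction
  have hC : ∀ k, Φ k 0 = 0 ∧ (∀ w ∈ closedBall (0 : X k) (r k), Φ k w ∈ closedBall (0 : X 0) (r 0)) ∧
      (∀ w ∈ closedBall (0 : X k) (r k), 𝒬 k (Φ k w) = w) ∧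
      LipschitzOnWith (∏ j ∈ Finset.range k, ((N j)⁻¹ - c j)⁻¹) (Φ k) (closedBall (0 : X k) (r k)) ∧
      (∀ w ∈ closedBall (0 : X k) (r k), (st k).1.1 w = 0 → Eq₀ (Φ k w) = 0) := by
    intro k
    induction k with
    | zero =>
      refine ⟨rfl, fun w hw => hw, fun w _ => ?_, ?_, fun w _ h => h⟩
      · rw [h𝒬0]; rfl
      · rw [Finset.prod_range_zero]
        exact lipschitzOnWith_id_one _
    | succ k ih =>
      obtain ⟨ih0, ihm, ihq, ihl, ihz⟩ := ih
      obtain ⟨hσ0, ha, hlip, -, -, hd⟩ := hBr k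
      have hmaps : MapsTo (σ k) (closedBall (0 : X (k + 1)) (r (k + 1))) (closedBall (0 : X k) (r k)) :=
        fun w hw => (ha w (hsub k hw)).1
      refine ⟨?_, fun w hw => ?_, fun w hw => ?_, ?_, fun w hw h => ?_⟩
      · rw [hΦs, hσ0, ih0]
      · rw [hΦs]; exact ihm _ (hmaps hw)
      · -- the composite transport is a section of the composite blocking
        rw [hΦs, h𝒬 k, ContinuousLinearMap.comp_apply, ihq _ (hmaps hw)]
        exact (ha w (hsub k hw)).2.1
      · rw [prod_range_succ_K₁]
        exact ihl.comp (hlip.mono (hsub k)) hmaps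
      · rw [hΦs]
        rw [hEs] at h
        exact ihz _ (hmaps hw) (hd w (hsub k hw) h)
  refine ⟨σ, fun k => (st k).1.1, fun k => (st k).1.2.1, fun k => (st k).1.2.2, Φ, rfl, rfl, rfl, rfl,
    fun k => rfl, fun k => rfl, fun k => rfl, fun k => rfl, fun k => (st k).2, fun k => ?_, hC⟩
  -- (B): the branch letters, the lift identity read in tower form
  obtain ⟨hσ0, ha, hlip, huniq, hb, -⟩ := hBr k
  exact ⟨hσ0, fun w hw => ha w hw, hlip, huniq, hb⟩

/-! ## §3. Constant blocking: ONE field space at every level (the `ℓ^∞(ℤ^d)` shape — the coarse lattice is again `ℤ^d`) -/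

/-- **THE TOWER WITH CONSTANT BLOCKING.**  `tower_eq` on the constant family `X k = E`, `K k = K₀` with one blocking `(Q, Lp, P, ι)` at
every level, composite blockings the POWERS `Q ^ k`, charts `T k : E ≃L E × K₀` read on admissible sections of `Q ^ k`; the same
conclusions with non-dependent families `σ Eq Φ : ℕ → E → E`, `Eq′ : ℕ → E → E →L E`, `𝒮 : ℕ → E →L E`. [folklore] -/
theorem tower_eq_const {E K₀ : Type*} [NormedAddCommGroup E] [NormedSpace ℝ E] [CompleteSpace E] [Nontrivial E]
    [NormedAddCommGroup K₀] [NormedSpace ℝ K₀]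
    (Q : E →L[ℝ] E) (Lp : E →L[ℝ] E) (P : E →L[ℝ] K₀) (ι : K₀ →L[ℝ] E) (hPι : ∀ h, ι (P h) = h - Lp (Q h))
    {CP : ℝ} (hCP : ‖P‖ ≤ CP)
    {Eq₀ : E → E} {Eq₀' : E → E →L[ℝ] E} (hE0 : Eq₀ 0 = 0)
    {r B M : ℕ → ℝ} (hr0 : ∀ k, 0 ≤ r k) (hM0 : ∀ k, 0 ≤ M k)
    (hE : ∀ x ∈ closedBall (0 : E) (r 0), HasFDerivAt Eq₀ (Eq₀' x) x)
    (hB : ∀ x ∈ closedBall (0 : E) (r 0), ‖Eq₀' x‖ ≤ B 0)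
    (hM : ∀ x ∈ closedBall (0 : E) (r 0), ∀ x' ∈ closedBall (0 : E) (r 0), ‖Eq₀' x - Eq₀' x'‖ ≤ M 0 * ‖x - x'‖)
    (T : ℕ → (E ≃L[ℝ] E × K₀)) {N c : ℕ → ℝ≥0}
    (hT : ∀ k (𝒮 : E →L[ℝ] E), (Q ^ k).comp 𝒮 = ContinuousLinearMap.id ℝ E →
      (∀ j, j < k → ∀ h, P ((Q ^ j) (Eq₀' 0 (𝒮 h))) = 0) → ∀ h, T k h = (Q h, P ((Q ^ k) (Eq₀' 0 (𝒮 h)))))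
    (hN : ∀ k (y : E × K₀), ‖(T k).symm y‖ ≤ N k * ‖y‖) (hcN : ∀ k, c k < (N k)⁻¹)
    (hc : ∀ k, CP * M k * r k ≤ (c k : ℝ)) (hr : ∀ k, r (k + 1) < ((N k : ℝ)⁻¹ - c k) * r k)
    (hBs : ∀ k, ‖Q‖ * B k * ((N k : ℝ)⁻¹ - c k)⁻¹ ≤ B (k + 1))
    (hMs : ∀ k, ‖Q‖ * (M k * ((N k : ℝ)⁻¹ - c k)⁻¹ * ((N k : ℝ)⁻¹ - c k)⁻¹ +
      B k * ((((N k : ℝ)⁻¹ - c k)⁻¹) ^ 2 * (CP * M k) * ((N k : ℝ)⁻¹ - c k)⁻¹)) ≤ M (k + 1)) :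
    ∃ (σ : ℕ → E → E) (Eq : ℕ → E → E) (Eq' : ℕ → E → E →L[ℝ] E) (𝒮 : ℕ → E →L[ℝ] E) (Φ : ℕ → E → E),
      Eq 0 = Eq₀ ∧ Eq' 0 = Eq₀' ∧ 𝒮 0 = ContinuousLinearMap.id ℝ E ∧ Φ 0 = id ∧
      (∀ k, Eq (k + 1) = fun w => Q (Eq k (σ k w))) ∧
      (∀ k, Eq' (k + 1) = fun w => Q.comp ((Eq' k (σ k w)).comp (fderiv ℝ (σ k) w))) ∧
      (∀ k, 𝒮 (k + 1) = (𝒮 k).comp (fderiv ℝ (σ k) 0)) ∧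
      (∀ k, Φ (k + 1) = Φ k ∘ σ k) ∧
      (∀ k, Eq k 0 = 0 ∧ (∀ x ∈ closedBall (0 : E) (r k), HasFDerivAt (Eq k) (Eq' k x) x) ∧
        (∀ x ∈ closedBall (0 : E) (r k), ‖Eq' k x‖ ≤ B k) ∧
        (∀ x ∈ closedBall (0 : E) (r k), ∀ x' ∈ closedBall (0 : E) (r k), ‖Eq' k x - Eq' k x'‖ ≤ M k * ‖x - x'‖) ∧
        (Q ^ k).comp (𝒮 k) = ContinuousLinearMap.id ℝ E ∧
        (∀ j, j < k → ∀ h, P ((Q ^ j) (Eq₀' 0 (𝒮 k h))) = 0) ∧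
        Eq' k 0 = (Q ^ k).comp ((Eq₀' 0).comp (𝒮 k))) ∧
      (∀ k, σ k 0 = 0 ∧
        (∀ w ∈ closedBall (0 : E) (((N k : ℝ)⁻¹ - c k) * r k),
          σ k w ∈ closedBall (0 : E) (r k) ∧ Q (σ k w) = w ∧ P (Eq k (σ k w)) = 0 ∧ Eq k (σ k w) = Lp (Eq (k + 1) w)) ∧
        LipschitzOnWith ((N k)⁻¹ - c k)⁻¹ (σ k) (closedBall (0 : E) (((N k : ℝ)⁻¹ - c k) * r k)) ∧
        (∀ x ∈ closedBall (0 : E) (r k), P (Eq k x) = 0 → σ k (Q x) = x) ∧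
        (∀ w ∈ ball (0 : E) (((N k : ℝ)⁻¹ - c k) * r k), DifferentiableAt ℝ (σ k) w ∧
          ‖fderiv ℝ (σ k) w‖ ≤ ((N k : ℝ)⁻¹ - c k)⁻¹ ∧ Q.comp (fderiv ℝ (σ k) w) = ContinuousLinearMap.id ℝ E)) ∧
      (∀ k, Φ k 0 = 0 ∧ (∀ w ∈ closedBall (0 : E) (r k), Φ k w ∈ closedBall (0 : E) (r 0)) ∧
        (∀ w ∈ closedBall (0 : E) (r k), (Q ^ k) (Φ k w) = w) ∧
        LipschitzOnWith (∏ j ∈ Finset.range k, ((N j)⁻¹ - c j)⁻¹) (Φ k) (closedBall (0 : E) (r k)) ∧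
        (∀ w ∈ closedBall (0 : E) (r k), Eq k w = 0 → Eq₀ (Φ k w) = 0)) :=
  tower_eq (X := fun _ => E) (K := fun _ => K₀) (fun _ => Q) (fun _ => Lp) (fun _ => P) (fun _ => ι) (fun _ => hPι)
    (fun _ => hCP) (fun k => Q ^ k) (pow_zero Q) (fun k => by rw [pow_succ']; rfl) hE0 hr0 hM0 hE hB hM T hT hN hcN hc hr
    hBs hMs

/-! ## §4. Toy -/

/-- Toy: the product letter after two levels with `N₀⁻¹ − c₀ = N₁⁻¹ − c₁ = 1∕2` is `2·2 = 4` — the composite section's Lipschitz letter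
compounds, as the pricing desk located. -/
example : ((2 : ℝ≥0)⁻¹)⁻¹ * ((2 : ℝ≥0)⁻¹)⁻¹ = 4 := by norm_num

end Summit.QuantumFields.BalabanUV.T4Continuum.NE7b.SupEquationTower

end
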